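import Literature.Dynamics.Billiards.SlavedUnstablePlaques
import Literature.Dynamics.Billiards.InfiniteUnstablePlaquesTeeth
import Literature.Analysis.FluidPDE.ControlledHardSphereDynamics
import HarnessLib

/-!
# No ghost recoil: the two-body test of the contact-slaved window dynamics

Topic `Literature/Dynamics/Billiards`; companion of
`Literature.Dynamics.Billiards.SlavedUnstablePlaques` (definition item `defn-SlavedUnstablePlaques`,
route UGibbsSRBRigidity, acceptance lemma (G) NO GHOST RECOIL — the test that D4's window dynamics
fails). TWO-BODY TOY: one window label `p`, one exterior label `q`; the record consists of two free
flights with ONE non-grazing contact at reversed time `s₀ > 0` (`TwoBodyRecord`: recorded reversed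
data `P`, `Q` of `p`, `q`, diameter `ε > 0`, contact `‖(P.1 - Q.1) + s₀ (P.2 - Q.2)‖ = ε`,
non-grazing `⟪(P.1 - Q.1) + s₀ (P.2 - Q.2), P.2 - Q.2⟫ < 0`). For window data `y` of `p` close to
the recorded datum `P` we prove (`TwoBodyRecord.noGhostRecoil`):

* EXISTENCE: the explicit pair of paths `toyTraj p y` — free flights of `p` from `y` and of `q`
  from `Q` up to the perturbed contact time `contactTime y`, then the two-body elastic law and free
  flights — is a slaved trajectory (`IsSlavedTrajectory ε {p} {p, q} (recPath p) (toyTraj p y)`)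
  with window datum `y` (`isSlavedTrajectory_toyTraj`);
* UNIQUENESS: every slaved trajectory with window datum `y` coincides with it at all `s ≥ 0`
  (`eq_toyTraj`);
* ONE CONTACT: `p` and `q` touch exactly once on `[0, ∞)`, at `contactTime y`, and
  `|contactTime y - s₀| ≤ C · dist y P` — early or LATE data still collide;
* LIPSCHITZ RESPONSE: after the contact the velocity of `p` is within `C · dist y P` of the recorded
  outgoing velocity, and the state of `p` at the final time `s₀ + 1` is within `C · dist y P` of the
  recorded one.

In D4's dynamics (`IsWindowTrajectory` with the exterior glued to the record) the partner `q`
recoils at `s₀` on the clock whatever `p` does, so late data miss it and keep an `O(1)` velocity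
error; here `q` flies on until the actual contact (its recorded recoil off the window particle is
not a clock instant) and responds elastically there.

## Contents and proof sketch

1. `postVel`, `collidePath a b τ` (free flight of `a` up to time `τ`, then the outgoing velocity of
   the elastic law against the free flight of `b`; left-continuous velocity) and their calculus.
2. `TwoBodyRecord` and the gap function `gap y s = ‖(y.1 - Q.1) + s (y.2 - Q.2)‖² - ε²` (a convex
   quadratic in `s`; expansion `gap_eq_add`); record facts: `gap P s ≥ 2κ(s₀ - s)` before `s₀`,
   `gap P (s₀ + η₁) ≤ -κη₁`, `|gap P s| ≥ κ|s - s₀|` near `s₀` (`κ = -⟪n₀, w₀⟫ > 0`); Lipschitz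
   dependence on `y` (`abs_gap_sub_le`).
3. The perturbed contact time `contactTime y = sInf {s ≥ 0 | gap y s ≤ 0}`: for `dist y P ≤ δ₀`
   it is positive, `gap y > 0` before it, `gap y (contactTime y) = 0`, `|contactTime y - s₀| ≤
   (L/κ) dist y P`, the perturbed contact is non-grazing, and after an elastic reflection the pair
   separates (`lt_norm_add_smul_of_inner_pos`, `inner_reflectVel_fst_sub_snd`).
4. `toyTraj`, its single contact, EXISTENCE (every clause of `IsSlavedTrajectory` checked).
5. UNIQUENESS: before the first contact both particles fly freely from their data (free-flight
   clauses anchored at right endpoints), so the first contact is `contactTime y`; after it the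
   right limits of the velocities are the elastic ones, free flight resumes, and the separating pair
   never touches again.
6. The estimates and the headline theorem `TwoBodyRecord.noGhostRecoil`.

## References (templates; the object is route-posited)

* N. Chernov, D. Dolgopyat, *Brownian Brownian motion I*, Mem. AMS 198 (2009) [ChernovDolgopyat2009].
* M. Stenlund, L.-S. Young, H. Zhang, CMP 322 (2013) [StenlundYoungZhang2013].
-/

noncomputable section

open MeasureTheory Set Filter Metric Function Topology
open scoped ENNReal NNReal InnerProductSpace
open Literature.Analysis.FunctionSpaces Literature.Analysis.FluidPDE

namespace Literature.Dynamics.Billiards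

section NoGhostFile

variable {d : Type*} [Fintype d]

local notation "𝔼" => EuclideanSpace ℝ d
local notation "𝕏" => EuclideanSpace ℝ d × EuclideanSpace ℝ d

/-! ## 1. Free flight followed by one elastic reflection -/

/-- The outgoing velocity of a particle with (reversed) datum `a` after an elastic contact at time
`τ` with a particle of datum `b`, both in free flight up to `τ`: the first component of the elastic
law for the impact direction `(a.1 + τ a.2) - (b.1 + τ b.2)`. [folklore] -/
def postVel (a b : 𝕏) (τ : ℝ) : 𝔼 :=
  (reflectVel ((a.1 + τ • a.2) - (b.1 + τ • b.2)) (a.2, b.2)).1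

/-- **Free flight, one elastic reflection at time `τ`, free flight**: the path of the particle with
datum `a` colliding at time `τ` with the particle of datum `b` (LEFT-continuous velocity: at `τ` the
velocity is still the incoming one). [folklore] -/
def collidePath (a b : 𝕏) (τ : ℝ) (s : ℝ) : 𝕏 :=
  if s ≤ τ then (a.1 + s • a.2, a.2) else (a.1 + τ • a.2 + (s - τ) • postVel a b τ, postVel a b τ)

/-- Before the contact: free flight from the datum. [folklore] -/
theorem collidePath_of_le {a b : 𝕏} {τ s : ℝ} (h : s ≤ τ) :
    collidePath a b τ s = (a.1 + s • a.2, a.2) := by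
  simp [collidePath, h]

/-- After the contact: free flight with the outgoing velocity. [folklore] -/
theorem collidePath_of_lt {a b : 𝕏} {τ s : ℝ} (h : τ < s) :
    collidePath a b τ s = (a.1 + τ • a.2 + (s - τ) • postVel a b τ, postVel a b τ) := by
  simp [collidePath, not_le.2 h]

/-- At time `0 ≤ τ` the path starts from its datum. [folklore] -/
theorem collidePath_zero {a b : 𝕏} {τ : ℝ} (h : 0 ≤ τ) : collidePath a b τ 0 = a := by
  rw [collidePath_of_le h]
  simp

/-- The position along `collidePath` is continuous. [folklore] -/
theorem continuous_collidePath_fst (a b : 𝕏) (τ : ℝ) :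
    Continuous fun s => (collidePath a b τ s).1 := by
  have h : (fun s => (collidePath a b τ s).1) = fun s : ℝ =>
      if s ≤ τ then a.1 + s • a.2 else a.1 + τ • a.2 + (s - τ) • postVel a b τ := by
    funext s
    by_cases hs : s ≤ τ
    · rw [collidePath_of_le hs, if_pos hs]
    · rw [collidePath_of_lt (not_le.1 hs), if_neg hs]
  rw [h]
  refine Continuous.if_le (by fun_prop) (by fun_prop) continuous_id continuous_const ?_
  rintro s rfl
  simp

/-- **Free flight of `collidePath` on intervals avoiding the contact time**, anchored at the right
endpoint. [folklore] -/
theorem collidePath_free {a b : 𝕏} {τ σ b' : ℝ} (hσb : σ ≤ b') (h : b' ≤ τ ∨ τ < σ) :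
    collidePath a b τ σ =
      ((collidePath a b τ b').1 + (σ - b') • (collidePath a b τ b').2, (collidePath a b τ b').2) := by
  rcases h with h | h
  · rw [collidePath_of_le (hσb.trans h), collidePath_of_le h, Prod.mk.injEq]
    exact ⟨by module, rfl⟩
  · rw [collidePath_of_lt h, collidePath_of_lt (h.trans_le hσb), Prod.mk.injEq]
    exact ⟨by module, rfl⟩

/-- The velocity along `collidePath` has the right limit `postVel` at the contact time. [folklore] -/
theorem tendsto_collidePath_snd (a b : 𝕏) (τ : ℝ) :
    Tendsto (fun s => (collidePath a b τ s).2) (𝓝[>] τ) (𝓝 (postVel a b τ)) := by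
  refine tendsto_const_nhds.congr' (eventually_nhdsWithin_of_forall fun s hs => ?_)
  simp only [collidePath_of_lt (mem_Ioi.1 hs)]

/-- Relative position of two colliding free flights before the contact. [folklore] -/
theorem collidePath_fst_sub_of_le {a b : 𝕏} {τ s : ℝ} (h : s ≤ τ) :
    (collidePath a b τ s).1 - (collidePath b a τ s).1 = (a.1 - b.1) + s • (a.2 - b.2) := by
  rw [collidePath_of_le h, collidePath_of_le h]
  module

/-- Relative position of two colliding free flights after the contact. [folklore] -/
theorem collidePath_fst_sub_of_lt {a b : 𝕏} {τ s : ℝ} (h : τ < s) :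
    (collidePath a b τ s).1 - (collidePath b a τ s).1 =
      ((a.1 - b.1) + τ • (a.2 - b.2)) + (s - τ) • (postVel a b τ - postVel b a τ) := by
  rw [collidePath_of_lt h, collidePath_of_lt h]
  module

omit [Fintype d] in
/-- The impact direction written in the two natural ways. [folklore] -/
theorem impact_eq (a b : 𝕏) (τ : ℝ) :
    (a.1 + τ • a.2) - (b.1 + τ • b.2) = (a.1 - b.1) + τ • (a.2 - b.2) := by
  module

/-- The partner's outgoing velocity is the second component of the same elastic law (the
reflection law is even in the impact direction and symmetric under exchange). [folklore] -/
theorem postVel_swap (a b : 𝕏) (τ : ℝ) :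
    postVel b a τ = (reflectVel ((a.1 + τ • a.2) - (b.1 + τ • b.2)) (a.2, b.2)).2 := by
  rw [postVel, show (b.1 + τ • b.2) - (a.1 + τ • a.2) = -((a.1 + τ • a.2) - (b.1 + τ • b.2)) by
    abel, reflectVel_neg]
  exact congrArg Prod.fst (reflectVel_swap _ (a.2, b.2))

/-- **An elastic reflection reverses the normal relative velocity**: for an impact direction `n ≠ 0`
and incoming velocities `(v, w)`, `⟪n, v' - w'⟫ = -⟪n, v - w⟫`. [folklore] -/
theorem inner_reflectVel_fst_sub_snd {n : 𝔼} (hn : n ≠ 0) (v : 𝔼 × 𝔼) :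
    ⟪n, (reflectVel n v).1 - (reflectVel n v).2⟫_ℝ = -⟪n, v.1 - v.2⟫_ℝ := by
  have hn' : ‖n‖ ^ 2 ≠ 0 := pow_ne_zero _ (norm_ne_zero_iff.2 hn)
  rw [reflectVel_fst_sub_snd, inner_sub_right, inner_smul_right, real_inner_self_eq_norm_sq,
    real_inner_comm n]
  field_simp
  ring

/-- After a non-grazing elastic contact at distance `ε` the two free flights separate: the
distance exceeds `ε` at all later times. [folklore] -/
theorem lt_norm_add_smul_of_inner_pos {n u : 𝔼} {ε t : ℝ} (hn : ‖n‖ = ε)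
    (hu : 0 < ⟪n, u⟫_ℝ) (ht : 0 < t) : ε < ‖n + t • u‖ := by
  refine lt_of_pow_lt_pow_left₀ 2 (norm_nonneg _) ?_
  rw [norm_add_sq_real, hn, inner_smul_right, norm_smul, mul_pow, Real.norm_eq_abs, sq_abs]
  nlinarith [sq_nonneg (t * ‖u‖), mul_pos ht hu]

/-- … and is at least `ε` from the contact on. [folklore] -/
theorem le_norm_add_smul_of_inner_pos {n u : 𝔼} {ε t : ℝ} (hn : ‖n‖ = ε)
    (hu : 0 < ⟪n, u⟫_ℝ) (ht : 0 ≤ t) : ε ≤ ‖n + t • u‖ := by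
  rcases ht.eq_or_lt with rfl | ht
  · simp [hn]
  · exact (lt_norm_add_smul_of_inner_pos hn hu ht).le

/-! ## 2. Two-body records and the gap function -/

variable (d) in
/-- A **two-body record** for the no-ghost-recoil test: reversed time-`0` data `P` (window particle)
and `Q` (exterior particle) of two free flights of spheres of diameter `ε > 0` with ONE contact, at
reversed time `s₀ > 0`, which is non-grazing for the incoming velocities. (Hypothesis structure of
the toy model; route-posited.) [folklore] -/
structure TwoBodyRecord where
  /-- The diameter. -/
  ε : ℝ
  /-- The recorded contact time (reversed time). -/
  s₀ : ℝ
  /-- The recorded reversed datum of the window particle. -/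
  P : EuclideanSpace ℝ d × EuclideanSpace ℝ d
  /-- The recorded reversed datum of the exterior particle. -/
  Q : EuclideanSpace ℝ d × EuclideanSpace ℝ d
  ε_pos : 0 < ε
  s₀_pos : 0 < s₀
  /-- Contact at time `s₀`. -/
  contact : ‖(P.1 - Q.1) + s₀ • (P.2 - Q.2)‖ = ε
  /-- The contact is non-grazing (incoming pair). -/
  graze : ⟪(P.1 - Q.1) + s₀ • (P.2 - Q.2), P.2 - Q.2⟫_ℝ < 0

namespace TwoBodyRecord

variable (R : TwoBodyRecord d)

/-- Relative position at time `s` of the free flights from the data `y` and `R.Q`. [folklore] -/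
def relPos (y : 𝕏) (s : ℝ) : 𝔼 :=
  (y.1 - R.Q.1) + s • (y.2 - R.Q.2)

/-- The **gap function** `‖relPos y s‖² - ε²` (a convex quadratic in `s`; its first nonnegative
zero is the contact time). [folklore] -/
def gap (y : 𝕏) (s : ℝ) : ℝ :=
  ‖R.relPos y s‖ ^ 2 - R.ε ^ 2

/-- The recorded impact direction `n₀`. [folklore] -/
def n₀ : 𝔼 :=
  R.relPos R.P R.s₀

/-- The recorded incoming relative velocity `w₀`. [folklore] -/
def w₀ : 𝔼 :=
  R.P.2 - R.Q.2

/-- The non-grazing margin `κ = -⟪n₀, w₀⟫ > 0`. [folklore] -/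
def κ : ℝ :=
  -⟪R.n₀, R.w₀⟫_ℝ

/-- Unfolding lemma. [folklore] -/
theorem n₀_eq : R.n₀ = (R.P.1 - R.Q.1) + R.s₀ • (R.P.2 - R.Q.2) :=
  rfl

/-- The margin is positive. [folklore] -/
theorem κ_pos : 0 < R.κ := by
  rw [κ, neg_pos]
  exact R.graze

/-- The recorded impact direction has length `ε`. [folklore] -/
theorem norm_n₀ : ‖R.n₀‖ = R.ε :=
  R.contact

/-- The recorded incoming relative velocity is nonzero. [folklore] -/
theorem norm_w₀_pos : 0 < ‖R.w₀‖ := by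
  refine norm_pos_iff.2 fun h => ?_
  have := R.graze
  rw [show R.P.2 - R.Q.2 = R.w₀ from rfl, h, inner_zero_right] at this
  exact lt_irrefl _ this

/-- Free flight: the relative position at time `t` from the one at time `s`. [folklore] -/
theorem relPos_eq_add (y : 𝕏) (s t : ℝ) :
    R.relPos y t = R.relPos y s + (t - s) • (y.2 - R.Q.2) := by
  simp only [relPos]
  module

/-- **Expansion of the gap function** around any base time (it is a convex quadratic). [folklore] -/
theorem gap_eq_add (y : 𝕏) (s t : ℝ) :
    R.gap y t = R.gap y s + 2 * (t - s) * ⟪R.relPos y s, y.2 - R.Q.2⟫_ℝ +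
      (t - s) ^ 2 * ‖y.2 - R.Q.2‖ ^ 2 := by
  simp only [gap]
  rw [R.relPos_eq_add y s t, norm_add_sq_real, norm_smul, inner_smul_right, mul_pow,
    Real.norm_eq_abs, sq_abs]
  ring

/-- The gap function is continuous in time. [folklore] -/
theorem continuous_gap (y : 𝕏) : Continuous fun s => R.gap y s := by
  unfold gap relPos
  fun_prop

/-- The record is in contact at `s₀`. [folklore] -/
theorem gap_P_s₀ : R.gap R.P R.s₀ = 0 := by
  rw [gap, show R.relPos R.P R.s₀ = R.n₀ from rfl, R.norm_n₀, sub_self]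

/-- The recorded gap is bounded below linearly (convexity): `gap P s ≥ 2κ (s₀ - s)` for all
`s`. [folklore] -/
theorem gap_P_ge (s : ℝ) : 2 * R.κ * (R.s₀ - s) ≤ R.gap R.P s := by
  rw [R.gap_eq_add R.P R.s₀ s, R.gap_P_s₀]
  simp only [κ, n₀, w₀]
  nlinarith [sq_nonneg (s - R.s₀), sq_nonneg ‖R.P.2 - R.Q.2‖,
    mul_nonneg (sq_nonneg (s - R.s₀)) (sq_nonneg ‖R.P.2 - R.Q.2‖)]

/-- The half-width `η₁` of the time window around `s₀` (`η₁ ≤ 1/2`, `η₁ ≤ s₀/2`,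
`η₁ ‖w₀‖² ≤ κ`). [folklore] -/
def η₁ : ℝ :=
  min (min (1 / 2) (R.s₀ / 2)) (R.κ / ‖R.w₀‖ ^ 2)

/-- `η₁ > 0`. [folklore] -/
theorem η₁_pos : 0 < R.η₁ :=
  lt_min (lt_min one_half_pos (half_pos R.s₀_pos)) (div_pos R.κ_pos (pow_pos R.norm_w₀_pos 2))

/-- `η₁ ≤ 1/2`. [folklore] -/
theorem η₁_le_half : R.η₁ ≤ 1 / 2 :=
  (min_le_left _ _).trans (min_le_left _ _)

/-- `η₁ ≤ s₀/2`. [folklore] -/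
theorem η₁_le_half_s₀ : R.η₁ ≤ R.s₀ / 2 :=
  (min_le_left _ _).trans (min_le_right _ _)

/-- `η₁ ‖w₀‖² ≤ κ`. [folklore] -/
theorem η₁_mul_le : R.η₁ * ‖R.w₀‖ ^ 2 ≤ R.κ := by
  have h : R.η₁ ≤ R.κ / ‖R.w₀‖ ^ 2 := min_le_right _ _
  rwa [le_div_iff₀ (pow_pos R.norm_w₀_pos 2)] at h

/-- Just after the recorded contact the recorded free flights overlap:
`gap P (s₀ + η₁) ≤ -κ η₁`. [folklore] -/
theorem gap_P_end : R.gap R.P (R.s₀ + R.η₁) ≤ -(R.κ * R.η₁) := by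
  rw [R.gap_eq_add R.P R.s₀ (R.s₀ + R.η₁), R.gap_P_s₀]
  have h1 : ⟪R.relPos R.P R.s₀, R.P.2 - R.Q.2⟫_ℝ = -R.κ := by simp [κ, n₀, w₀]
  rw [h1, show ‖R.P.2 - R.Q.2‖ = ‖R.w₀‖ from rfl]
  nlinarith [R.η₁_mul_le, R.η₁_pos]

/-- Near `s₀` the recorded gap is bounded away from zero linearly: `κ |s - s₀| ≤ |gap P s|` for
`|s - s₀| ≤ η₁`. [folklore] -/
theorem abs_gap_P_ge {s : ℝ} (hs : |s - R.s₀| ≤ R.η₁) : R.κ * |s - R.s₀| ≤ |R.gap R.P s| := by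
  have hexp : R.gap R.P s = -(2 * R.κ * (s - R.s₀)) + (s - R.s₀) ^ 2 * ‖R.w₀‖ ^ 2 := by
    rw [R.gap_eq_add R.P R.s₀ s, R.gap_P_s₀]
    simp [κ, n₀, w₀]
    ring
  have hκ := R.κ_pos
  have hηw := R.η₁_mul_le
  rcases le_or_gt s R.s₀ with hle | hgt
  · rw [abs_of_nonpos (sub_nonpos.2 hle)]
    refine le_trans ?_ (le_abs_self _)
    rw [hexp]
    nlinarith [mul_nonneg (sq_nonneg (s - R.s₀)) (sq_nonneg ‖R.w₀‖)]
  · have hpos : 0 < s - R.s₀ := sub_pos.2 hgt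
    rw [abs_of_pos hpos] at hs ⊢
    refine le_trans ?_ (neg_le_abs _)
    rw [hexp]
    have h2 : (s - R.s₀) ^ 2 * ‖R.w₀‖ ^ 2 ≤ (s - R.s₀) * R.κ := by
      have : (s - R.s₀) * ‖R.w₀‖ ^ 2 ≤ R.η₁ * ‖R.w₀‖ ^ 2 :=
        mul_le_mul_of_nonneg_right hs (sq_nonneg _)
      nlinarith
    nlinarith

/-! ### Lipschitz dependence of the gap on the window datum -/

/-- Components are `1`-Lipschitz for the product distance. [folklore] -/
theorem dist_fst_le' (a b : 𝕏) : dist a.1 b.1 ≤ dist a b := by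
  rw [Prod.dist_eq]; exact le_max_left _ _

/-- Components are `1`-Lipschitz for the product distance. [folklore] -/
theorem dist_snd_le' (a b : 𝕏) : dist a.2 b.2 ≤ dist a b := by
  rw [Prod.dist_eq]; exact le_max_right _ _

/-- The relative position is Lipschitz in the datum: `‖relPos y s - relPos P s‖ ≤ (1 + |s|) dist y P`.
[folklore] -/
theorem norm_relPos_sub_le (y : 𝕏) (s : ℝ) :
    ‖R.relPos y s - R.relPos R.P s‖ ≤ (1 + |s|) * dist y R.P := by
  have h : R.relPos y s - R.relPos R.P s = (y.1 - R.P.1) + s • (y.2 - R.P.2) := by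
    simp only [relPos]; module
  rw [h]
  refine (norm_add_le _ _).trans ?_
  rw [norm_smul, Real.norm_eq_abs, ← dist_eq_norm, ← dist_eq_norm, add_mul, one_mul]
  exact add_le_add (dist_fst_le' y R.P) (mul_le_mul_of_nonneg_left (dist_snd_le' y R.P)
    (abs_nonneg s))

/-- A bound `M` for the recorded relative position on `[0, s₀ + 1]`. [folklore] -/
def M : ℝ :=
  ‖R.P.1 - R.Q.1‖ + (R.s₀ + 1) * ‖R.w₀‖

/-- `‖relPos P s‖ ≤ M` on `[0, s₀ + 1]`. [folklore] -/
theorem norm_relPos_P_le {s : ℝ} (hs : s ∈ Icc 0 (R.s₀ + 1)) : ‖R.relPos R.P s‖ ≤ R.M := by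
  rw [relPos, M]
  refine (norm_add_le _ _).trans (add_le_add le_rfl ?_)
  rw [norm_smul, Real.norm_eq_abs, abs_of_nonneg hs.1]
  exact mul_le_mul_of_nonneg_right hs.2 (norm_nonneg _)

/-- The Lipschitz constant of the gap in the datum (on `[0, s₀ + 1]`, `dist y P ≤ 1`). [folklore] -/
def Lg : ℝ :=
  (2 + R.s₀) * ((2 + R.s₀) + 2 * R.M)

/-- `Lg > 0`. [folklore] -/
theorem Lg_pos : 0 < R.Lg := by
  have hs := R.s₀_pos
  have hM : 0 ≤ R.M := add_nonneg (norm_nonneg _) (mul_nonneg (by linarith) (norm_nonneg _))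
  unfold Lg
  positivity

/-- **The gap is Lipschitz in the window datum**: `|gap y s - gap P s| ≤ Lg · dist y P` for
`s ∈ [0, s₀ + 1]` and `dist y P ≤ 1`. [folklore] -/
theorem abs_gap_sub_le {y : 𝕏} (hy : dist y R.P ≤ 1) {s : ℝ} (hs : s ∈ Icc 0 (R.s₀ + 1)) :
    |R.gap y s - R.gap R.P s| ≤ R.Lg * dist y R.P := by
  set a := R.relPos y s with ha
  set b := R.relPos R.P s with hb
  have hab : ‖a - b‖ ≤ (2 + R.s₀) * dist y R.P := by
    refine (R.norm_relPos_sub_le y s).trans (mul_le_mul_of_nonneg_right ?_ dist_nonneg)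
    rw [abs_of_nonneg hs.1]; linarith [hs.2]
  have hab1 : ‖a - b‖ ≤ 2 + R.s₀ := by
    refine hab.trans ?_
    have : 0 ≤ 2 + R.s₀ := by linarith [R.s₀_pos]
    nlinarith
  have hbM : ‖b‖ ≤ R.M := R.norm_relPos_P_le hs
  have h1 : |R.gap y s - R.gap R.P s| = |‖a‖ - ‖b‖| * (‖a‖ + ‖b‖) := by
    rw [gap, gap, ← ha, ← hb, show ‖a‖ ^ 2 - R.ε ^ 2 - (‖b‖ ^ 2 - R.ε ^ 2) =
      (‖a‖ - ‖b‖) * (‖a‖ + ‖b‖) by ring, abs_mul,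
      abs_of_nonneg (add_nonneg (norm_nonneg a) (norm_nonneg b))]
  rw [h1]
  have h2 : |‖a‖ - ‖b‖| ≤ ‖a - b‖ := abs_norm_sub_norm_le a b
  have h3 : ‖a‖ + ‖b‖ ≤ ‖a - b‖ + 2 * ‖b‖ := by
    have := norm_le_norm_add_norm_sub' a b
    rw [norm_sub_rev] at this ⊢
    linarith
  calc |‖a‖ - ‖b‖| * (‖a‖ + ‖b‖) ≤ ‖a - b‖ * (‖a - b‖ + 2 * ‖b‖) :=
        mul_le_mul h2 h3 (add_nonneg (norm_nonneg _) (norm_nonneg _)) (norm_nonneg _)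
    _ ≤ ((2 + R.s₀) * dist y R.P) * ((2 + R.s₀) + 2 * R.M) := by
        refine mul_le_mul hab (by linarith) (add_nonneg (norm_nonneg _) (by positivity)) ?_
        exact mul_nonneg (by linarith [R.s₀_pos]) dist_nonneg
    _ = R.Lg * dist y R.P := by rw [Lg]; ring

/-! ## 3. The perturbed contact time -/

/-- The **perturbed contact time**: the first time `s ≥ 0` at which the free flights from `y` and
`Q` are at distance `≤ ε`. [folklore] -/
def contactTime (y : 𝕏) : ℝ :=
  sInf {s : ℝ | 0 ≤ s ∧ R.gap y s ≤ 0}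

/-- The Lipschitz constant of the impact direction in the datum. [folklore] -/
def Ln : ℝ :=
  (2 + R.s₀) + R.Lg / R.κ * ‖R.w₀‖

/-- The Lipschitz constant of the normal incoming velocity in the datum. [folklore] -/
def Li : ℝ :=
  R.Ln * (‖R.w₀‖ + 1) + R.ε

/-- `Ln ≥ 0`. [folklore] -/
theorem Ln_nonneg : 0 ≤ R.Ln := by
  have := R.s₀_pos
  have := R.Lg_pos
  have := R.κ_pos
  unfold Ln
  positivity

/-- `Li > 0`. [folklore] -/
theorem Li_pos : 0 < R.Li := by
  have := R.Ln_nonneg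
  have := R.ε_pos
  unfold Li
  positivity

/-- The **closeness threshold** `δ₀` for the window datum. [folklore] -/
def δ₀ : ℝ :=
  min 1 (min (R.κ * R.η₁ / (2 * R.Lg)) (R.κ / (2 * R.Li)))

/-- `δ₀ > 0`. [folklore] -/
theorem δ₀_pos : 0 < R.δ₀ :=
  lt_min one_pos (lt_min (div_pos (mul_pos R.κ_pos R.η₁_pos) (mul_pos two_pos R.Lg_pos))
    (div_pos R.κ_pos (mul_pos two_pos R.Li_pos)))

section Near

variable {R} {y : EuclideanSpace ℝ d × EuclideanSpace ℝ d}

/-- Close data are `1`-close. [folklore] -/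
theorem dist_le_one (hy : dist y R.P ≤ R.δ₀) : dist y R.P ≤ 1 :=
  hy.trans (min_le_left _ _)

/-- For close data the gap perturbation is at most `κ η₁ / 2`. [folklore] -/
theorem Lg_mul_dist_le (hy : dist y R.P ≤ R.δ₀) : R.Lg * dist y R.P ≤ R.κ * R.η₁ / 2 := by
  have h : dist y R.P ≤ R.κ * R.η₁ / (2 * R.Lg) :=
    hy.trans ((min_le_right _ _).trans (min_le_left _ _))
  have hL := R.Lg_pos
  calc R.Lg * dist y R.P ≤ R.Lg * (R.κ * R.η₁ / (2 * R.Lg)) := mul_le_mul_of_nonneg_left h hL.le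
    _ = R.κ * R.η₁ / 2 := by field_simp

/-- For close data the normal-velocity perturbation is at most `κ / 2`. [folklore] -/
theorem Li_mul_dist_le (hy : dist y R.P ≤ R.δ₀) : R.Li * dist y R.P ≤ R.κ / 2 := by
  have h : dist y R.P ≤ R.κ / (2 * R.Li) :=
    hy.trans ((min_le_right _ _).trans (min_le_right _ _))
  have hL := R.Li_pos
  calc R.Li * dist y R.P ≤ R.Li * (R.κ / (2 * R.Li)) := mul_le_mul_of_nonneg_left h hL.le
    _ = R.κ / 2 := by field_simp

/-- Before `s₀ - η₁` the perturbed free flights are apart: `gap y s > 0` on `[0, s₀ - η₁]`.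
[folklore] -/
theorem gap_pos_of_le (hy : dist y R.P ≤ R.δ₀) {s : ℝ} (hs0 : 0 ≤ s) (hs : s ≤ R.s₀ - R.η₁) :
    0 < R.gap y s := by
  have hη := R.η₁_pos
  have hκ := R.κ_pos
  have hsI : s ∈ Icc 0 (R.s₀ + 1) := ⟨hs0, by linarith⟩
  have h1 := R.gap_P_ge s
  have h2 := abs_le.1 ((R.abs_gap_sub_le (dist_le_one hy) hsI).trans (Lg_mul_dist_le hy))
  nlinarith [h2.1]

/-- At `s₀ + η₁` the perturbed free flights overlap: `gap y (s₀ + η₁) < 0`. [folklore] -/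
theorem gap_end_neg (hy : dist y R.P ≤ R.δ₀) : R.gap y (R.s₀ + R.η₁) < 0 := by
  have hη := R.η₁_pos
  have hκ := R.κ_pos
  have hsI : R.s₀ + R.η₁ ∈ Icc 0 (R.s₀ + 1) :=
    ⟨by linarith [R.s₀_pos], by linarith [R.η₁_le_half]⟩
  have h1 := R.gap_P_end
  have h2 := abs_le.1 ((R.abs_gap_sub_le (dist_le_one hy) hsI).trans (Lg_mul_dist_le hy))
  nlinarith [h2.2, mul_pos hκ hη]

/-- The defining set of the contact time is closed, nonempty and bounded below. [folklore] -/
theorem isClosed_contactSet : IsClosed {s : ℝ | 0 ≤ s ∧ R.gap y s ≤ 0} :=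
  (isClosed_Ici.inter (isClosed_le (R.continuous_gap y) continuous_const) :)

/-- The contact time lies in its defining set: it is nonnegative with nonpositive gap. [folklore] -/
theorem contactTime_mem (hy : dist y R.P ≤ R.δ₀) :
    0 ≤ R.contactTime y ∧ R.gap y (R.contactTime y) ≤ 0 := by
  have hne : {s : ℝ | 0 ≤ s ∧ R.gap y s ≤ 0}.Nonempty :=
    ⟨R.s₀ + R.η₁, by linarith [R.s₀_pos, R.η₁_pos], (gap_end_neg hy).le⟩
  exact isClosed_contactSet.csInf_mem hne ⟨0, fun s hs => hs.1⟩

/-- The contact time is at most `s₀ + η₁`. [folklore] -/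
theorem contactTime_le (hy : dist y R.P ≤ R.δ₀) : R.contactTime y ≤ R.s₀ + R.η₁ :=
  csInf_le ⟨0, fun s hs => hs.1⟩ ⟨by linarith [R.s₀_pos, R.η₁_pos], (gap_end_neg hy).le⟩

/-- Before the contact time the perturbed free flights are apart. [folklore] -/
theorem gap_pos_of_lt_contactTime {s : ℝ} (hs0 : 0 ≤ s) (hs : s < R.contactTime y) :
    0 < R.gap y s := by
  by_contra h
  exact notMem_of_lt_csInf hs ⟨0, fun s hs => hs.1⟩ ⟨hs0, not_lt.1 h⟩

/-- The contact time exceeds `s₀ - η₁`; in particular it is positive. [folklore] -/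
theorem lt_contactTime (hy : dist y R.P ≤ R.δ₀) : R.s₀ - R.η₁ < R.contactTime y := by
  by_contra h
  have h' := gap_pos_of_le hy (contactTime_mem hy).1 (not_lt.1 h)
  linarith [(contactTime_mem hy).2]

/-- The contact time is positive. [folklore] -/
theorem contactTime_pos (hy : dist y R.P ≤ R.δ₀) : 0 < R.contactTime y := by
  have := lt_contactTime hy
  linarith [R.η₁_le_half_s₀, R.s₀_pos]

/-- The contact time is within `η₁` of `s₀`. [folklore] -/
theorem abs_contactTime_sub_le (hy : dist y R.P ≤ R.δ₀) : |R.contactTime y - R.s₀| ≤ R.η₁ :=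
  abs_le.2 ⟨by linarith [lt_contactTime hy], by linarith [contactTime_le hy]⟩

/-- The contact time lies in `[0, s₀ + 1]`. [folklore] -/
theorem contactTime_mem_Icc (hy : dist y R.P ≤ R.δ₀) : R.contactTime y ∈ Icc 0 (R.s₀ + 1) :=
  ⟨(contactTime_mem hy).1, (contactTime_le hy).trans (by linarith [R.η₁_le_half])⟩

/-- **The perturbed free flights touch at the contact time**: `gap y (contactTime y) = 0`.
[folklore] -/
theorem gap_contactTime (hy : dist y R.P ≤ R.δ₀) : R.gap y (R.contactTime y) = 0 := by
  refine le_antisymm (contactTime_mem hy).2 (not_lt.1 fun hneg => ?_)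
  set T := R.contactTime y with hT
  have hTpos : 0 < T := contactTime_pos hy
  have h1 : ∀ᶠ s in 𝓝[<] T, R.gap y s < 0 :=
    (((R.continuous_gap y).tendsto T).eventually (gt_mem_nhds hneg)).filter_mono
      nhdsWithin_le_nhds
  have h2 : ∀ᶠ s in 𝓝[<] T, s ∈ Ioo 0 T := Ioo_mem_nhdsLT hTpos
  obtain ⟨s, hs1, hs2⟩ := (h1.and h2).exists
  exact absurd (gap_pos_of_lt_contactTime hs2.1.le hs2.2) (not_lt.2 hs1.le)

/-- The impact direction of the perturbed contact has length `ε`. [folklore] -/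
theorem norm_relPos_contactTime (hy : dist y R.P ≤ R.δ₀) :
    ‖R.relPos y (R.contactTime y)‖ = R.ε := by
  have h := gap_contactTime hy
  rw [gap, sub_eq_zero] at h
  exact (pow_left_inj₀ (norm_nonneg _) R.ε_pos.le two_ne_zero).1 h

/-- **Early or late by at most `C · dist`**: `|contactTime y - s₀| ≤ (Lg / κ) · dist y P`.
[folklore] -/
theorem abs_contactTime_sub_s₀_le (hy : dist y R.P ≤ R.δ₀) :
    |R.contactTime y - R.s₀| ≤ R.Lg / R.κ * dist y R.P := by
  have hκ := R.κ_pos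
  have h1 := R.abs_gap_P_ge (abs_contactTime_sub_le hy)
  have h2 : |R.gap R.P (R.contactTime y)| ≤ R.Lg * dist y R.P := by
    have h := R.abs_gap_sub_le (dist_le_one hy) (contactTime_mem_Icc hy)
    rwa [gap_contactTime hy, zero_sub, abs_neg] at h
  rw [div_mul_eq_mul_div, le_div_iff₀ hκ]
  nlinarith

/-- The perturbed impact direction is close to the recorded one:
`‖relPos y (contactTime y) - n₀‖ ≤ Ln · dist y P`. [folklore] -/
theorem norm_relPos_contactTime_sub_n₀_le (hy : dist y R.P ≤ R.δ₀) :
    ‖R.relPos y (R.contactTime y) - R.n₀‖ ≤ R.Ln * dist y R.P := by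
  set T := R.contactTime y with hT
  have hTI := contactTime_mem_Icc hy
  have h1 : ‖R.relPos y T - R.relPos R.P T‖ ≤ (2 + R.s₀) * dist y R.P := by
    refine (R.norm_relPos_sub_le y T).trans (mul_le_mul_of_nonneg_right ?_ dist_nonneg)
    rw [abs_of_nonneg hTI.1]; linarith [hTI.2]
  have h2 : ‖R.relPos R.P T - R.n₀‖ ≤ R.Lg / R.κ * ‖R.w₀‖ * dist y R.P := by
    rw [n₀, R.relPos_eq_add R.P R.s₀ T, add_sub_cancel_left, norm_smul, Real.norm_eq_abs,
      show R.P.2 - R.Q.2 = R.w₀ from rfl]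
    calc |T - R.s₀| * ‖R.w₀‖ ≤ (R.Lg / R.κ * dist y R.P) * ‖R.w₀‖ :=
          mul_le_mul_of_nonneg_right (abs_contactTime_sub_s₀_le hy) (norm_nonneg _)
      _ = R.Lg / R.κ * ‖R.w₀‖ * dist y R.P := by ring
  calc ‖R.relPos y T - R.n₀‖ ≤ ‖R.relPos y T - R.relPos R.P T‖ + ‖R.relPos R.P T - R.n₀‖ :=
        norm_sub_le_norm_sub_add_norm_sub _ _ _
    _ ≤ (2 + R.s₀) * dist y R.P + R.Lg / R.κ * ‖R.w₀‖ * dist y R.P := add_le_add h1 h2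
    _ = R.Ln * dist y R.P := by rw [Ln]; ring

/-- The normal incoming relative velocity of the perturbed contact is close to the recorded one:
`|⟪n_y, w_y⟫ - ⟪n₀, w₀⟫| ≤ Li · dist y P`. [folklore] -/
theorem abs_inner_sub_le (hy : dist y R.P ≤ R.δ₀) :
    |⟪R.relPos y (R.contactTime y), y.2 - R.Q.2⟫_ℝ - ⟪R.n₀, R.w₀⟫_ℝ| ≤ R.Li * dist y R.P := by
  set n := R.relPos y (R.contactTime y) with hn
  set w : 𝔼 := y.2 - R.Q.2 with hw
  have hw0 : w - R.w₀ = y.2 - R.P.2 := by simp only [hw, w₀]; abel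
  have hww : ‖w - R.w₀‖ ≤ dist y R.P := by
    rw [hw0, ← dist_eq_norm]; exact dist_snd_le' y R.P
  have hwle : ‖w‖ ≤ ‖R.w₀‖ + 1 := by
    have h := norm_le_norm_add_norm_sub' w R.w₀
    linarith [hww.trans (dist_le_one hy)]
  have hsplit : ∀ a b c e : 𝔼, ⟪a, c⟫_ℝ - ⟪b, e⟫_ℝ = ⟪a - b, c⟫_ℝ + ⟪b, c - e⟫_ℝ := by
    intro a b c e
    rw [inner_sub_left, inner_sub_right]; ring
  rw [hsplit]
  refine (abs_add_le _ _).trans ?_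
  have h1 : |⟪n - R.n₀, w⟫_ℝ| ≤ R.Ln * dist y R.P * (‖R.w₀‖ + 1) :=
    (abs_real_inner_le_norm _ _).trans (mul_le_mul (norm_relPos_contactTime_sub_n₀_le hy) hwle
      (norm_nonneg _) (mul_nonneg R.Ln_nonneg dist_nonneg))
  have h2 : |⟪R.n₀, w - R.w₀⟫_ℝ| ≤ R.ε * dist y R.P := by
    refine (abs_real_inner_le_norm _ _).trans ?_
    rw [R.norm_n₀]
    exact mul_le_mul_of_nonneg_left hww R.ε_pos.le
  calc |⟪n - R.n₀, w⟫_ℝ| + |⟪R.n₀, w - R.w₀⟫_ℝ|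
      ≤ R.Ln * dist y R.P * (‖R.w₀‖ + 1) + R.ε * dist y R.P := add_le_add h1 h2
    _ = R.Li * dist y R.P := by rw [Li]; ring

/-- **The perturbed contact is non-grazing**, with margin `κ/2`. [folklore] -/
theorem inner_relPos_contactTime_le (hy : dist y R.P ≤ R.δ₀) :
    ⟪R.relPos y (R.contactTime y), y.2 - R.Q.2⟫_ℝ ≤ -(R.κ / 2) := by
  have h1 := abs_le.1 ((abs_inner_sub_le hy).trans (Li_mul_dist_le hy))
  have h2 : ⟪R.n₀, R.w₀⟫_ℝ = -R.κ := by rw [κ, neg_neg]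
  linarith [h1.2]

/-- The perturbed contact is non-grazing. [folklore] -/
theorem inner_relPos_contactTime_neg (hy : dist y R.P ≤ R.δ₀) :
    ⟪R.relPos y (R.contactTime y), y.2 - R.Q.2⟫_ℝ < 0 := by
  have := inner_relPos_contactTime_le hy
  linarith [R.κ_pos]

end Near

/-! ## 4. The toy trajectory, its single contact, existence -/

/-- The outgoing velocity of the window particle after the perturbed contact. [folklore] -/
def uOut (y : 𝕏) : 𝔼 :=
  postVel y R.Q (R.contactTime y)

/-- The outgoing velocity of the exterior particle after the perturbed contact. [folklore] -/
def uOutQ (y : 𝕏) : 𝔼 :=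
  postVel R.Q y (R.contactTime y)

open Classical in
/-- The **record** of the two-body toy as a family of paths labelled by `𝕏`: the window label `p`
follows `collidePath P Q s₀`, every other label (the exterior particle) follows
`collidePath Q P s₀`. [folklore] -/
def recPath (p : 𝕏) : 𝕏 → ℝ → 𝕏 :=
  fun r => if r = p then collidePath R.P R.Q R.s₀ else collidePath R.Q R.P R.s₀

open Classical in
/-- The **toy trajectory** with window datum `y`: the window particle `p` flies freely from `y`,
the exterior particle from its recorded datum `Q`; they reflect elastically at the perturbed
contact time `contactTime y` and fly freely afterwards. [folklore] -/
def toyTraj (p : 𝕏) (y : 𝕏) : 𝕏 → ℝ → 𝕏 :=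
  fun r => if r = p then collidePath y R.Q (R.contactTime y)
    else collidePath R.Q y (R.contactTime y)

/-- The window path of the record. [folklore] -/
@[simp]
theorem recPath_self (p : 𝕏) : R.recPath p p = collidePath R.P R.Q R.s₀ := by
  simp [recPath]

/-- The exterior path of the record. [folklore] -/
theorem recPath_of_ne {p r : 𝕏} (h : r ≠ p) : R.recPath p r = collidePath R.Q R.P R.s₀ := by
  simp [recPath, h]

/-- The window path of the toy trajectory. [folklore] -/
@[simp]
theorem toyTraj_self (p y : 𝕏) : R.toyTraj p y p = collidePath y R.Q (R.contactTime y) := by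
  simp [toyTraj]

/-- The exterior path of the toy trajectory. [folklore] -/
theorem toyTraj_of_ne {p r : 𝕏} (y : 𝕏) (h : r ≠ p) :
    R.toyTraj p y r = collidePath R.Q y (R.contactTime y) := by
  simp [toyTraj, h]

omit [Fintype d] in
/-- Membership in the window `{p}`. [folklore] -/
theorem eq_of_mem_window {p r : 𝕏} (h : r ∈ ({p} : Set 𝕏)) : r = p :=
  mem_singleton_iff.1 h

omit [Fintype d] in
/-- Membership in the label set `{p, q}`. [folklore] -/
theorem eq_or_eq_of_mem_labels {p q r : 𝕏} (h : r ∈ ({p, q} : Set 𝕏)) : r = p ∨ r = q := by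
  simpa using h

section Toy

variable {R} {p q y : EuclideanSpace ℝ d × EuclideanSpace ℝ d}

/-- Relative position of the toy pair before the contact. [folklore] -/
theorem toy_rel_of_le (hpq : p ≠ q) {s : ℝ} (hs : s ≤ R.contactTime y) :
    (R.toyTraj p y p s).1 - (R.toyTraj p y q s).1 = R.relPos y s := by
  rw [toyTraj_self, R.toyTraj_of_ne y hpq.symm, collidePath_fst_sub_of_le hs]
  rfl

/-- Relative position of the toy pair after the contact. [folklore] -/
theorem toy_rel_of_lt (hpq : p ≠ q) {s : ℝ} (hs : R.contactTime y < s) :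
    (R.toyTraj p y p s).1 - (R.toyTraj p y q s).1 =
      R.relPos y (R.contactTime y) + (s - R.contactTime y) • (R.uOut y - R.uOutQ y) := by
  rw [toyTraj_self, R.toyTraj_of_ne y hpq.symm, collidePath_fst_sub_of_lt hs]
  rfl

/-- The perturbed impact direction is nonzero (close data). [folklore] -/
theorem relPos_contactTime_ne_zero (hy : dist y R.P ≤ R.δ₀) :
    R.relPos y (R.contactTime y) ≠ 0 := by
  rw [← norm_ne_zero_iff, norm_relPos_contactTime hy]
  exact R.ε_pos.ne'

/-- **The reflected pair separates**: the normal component of the outgoing relative velocity is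
minus the (negative) incoming one. [folklore] -/
theorem inner_relPos_uOut_sub (hy : dist y R.P ≤ R.δ₀) :
    ⟪R.relPos y (R.contactTime y), R.uOut y - R.uOutQ y⟫_ℝ =
      -⟪R.relPos y (R.contactTime y), y.2 - R.Q.2⟫_ℝ := by
  rw [uOut, uOutQ, postVel_swap y R.Q, postVel, impact_eq]
  exact inner_reflectVel_fst_sub_snd (relPos_contactTime_ne_zero hy) (y.2, R.Q.2)

/-- The outgoing normal relative velocity is positive. [folklore] -/
theorem inner_relPos_uOut_sub_pos (hy : dist y R.P ≤ R.δ₀) :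
    0 < ⟪R.relPos y (R.contactTime y), R.uOut y - R.uOutQ y⟫_ℝ := by
  rw [inner_relPos_uOut_sub hy, neg_pos]
  exact inner_relPos_contactTime_neg hy

/-- After the contact the toy pair is more than `ε` apart. [folklore] -/
theorem lt_norm_toy_rel_of_lt (hpq : p ≠ q) (hy : dist y R.P ≤ R.δ₀) {s : ℝ}
    (hs : R.contactTime y < s) : R.ε < ‖(R.toyTraj p y p s).1 - (R.toyTraj p y q s).1‖ := by
  rw [toy_rel_of_lt hpq hs]
  exact lt_norm_add_smul_of_inner_pos (norm_relPos_contactTime hy) (inner_relPos_uOut_sub_pos hy)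
    (sub_pos.2 hs)

/-- Before the contact the toy pair is more than `ε` apart. [folklore] -/
theorem lt_norm_toy_rel_of_lt_contactTime (hpq : p ≠ q) {s : ℝ} (hs0 : 0 ≤ s)
    (hs : s < R.contactTime y) : R.ε < ‖(R.toyTraj p y p s).1 - (R.toyTraj p y q s).1‖ := by
  rw [toy_rel_of_le hpq hs.le]
  refine lt_of_pow_lt_pow_left₀ 2 (norm_nonneg _) ?_
  have h := gap_pos_of_lt_contactTime hs0 hs
  rw [gap] at h
  linarith

/-- At the contact time the toy pair touches. [folklore] -/
theorem norm_toy_rel_contactTime (hpq : p ≠ q) (hy : dist y R.P ≤ R.δ₀) :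
    ‖(R.toyTraj p y p (R.contactTime y)).1 - (R.toyTraj p y q (R.contactTime y)).1‖ = R.ε := by
  rw [toy_rel_of_le hpq le_rfl]
  exact norm_relPos_contactTime hy

/-- **Exactly one contact**: on `[0, ∞)` the toy pair touches exactly at the contact time.
[folklore] -/
theorem toy_contact_iff (hpq : p ≠ q) (hy : dist y R.P ≤ R.δ₀) {s : ℝ} (hs0 : 0 ≤ s) :
    ‖(R.toyTraj p y p s).1 - (R.toyTraj p y q s).1‖ = R.ε ↔ s = R.contactTime y := by
  refine ⟨fun h => ?_, fun h => h ▸ norm_toy_rel_contactTime hpq hy⟩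
  rcases lt_trichotomy s (R.contactTime y) with hlt | heq | hgt
  · exact absurd h (lt_norm_toy_rel_of_lt_contactTime hpq hs0 hlt).ne'
  · exact heq
  · exact absurd h (lt_norm_toy_rel_of_lt hpq hy hgt).ne'

/-- Hard core of the toy pair at all `s ≥ 0`. [folklore] -/
theorem le_norm_toy_rel (hpq : p ≠ q) (hy : dist y R.P ≤ R.δ₀) {s : ℝ} (hs0 : 0 ≤ s) :
    R.ε ≤ ‖(R.toyTraj p y p s).1 - (R.toyTraj p y q s).1‖ := by
  rcases lt_trichotomy s (R.contactTime y) with hlt | heq | hgt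
  · exact (lt_norm_toy_rel_of_lt_contactTime hpq hs0 hlt).le
  · rw [heq, norm_toy_rel_contactTime hpq hy]
  · exact (lt_norm_toy_rel_of_lt hpq hy hgt).le

/-- The contact time is a collision event of the window particle. [folklore] -/
theorem toy_mem_collisionEvents (hpq : p ≠ q) (hy : dist y R.P ≤ R.δ₀) :
    (p, R.contactTime y) ∈ collisionEvents R.ε ({p, q} : Set 𝕏) (R.toyTraj p y) :=
  ⟨by simp, q, by simp, hpq.symm, norm_toy_rel_contactTime hpq hy⟩

/-- The contact time is a window-contact instant of the exterior particle. [folklore] -/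
theorem toy_mem_windowContactInstants (hpq : p ≠ q) (hy : dist y R.P ≤ R.δ₀) :
    R.contactTime y ∈ windowContactInstants R.ε ({p} : Set 𝕏) (R.toyTraj p y) q :=
  ⟨p, mem_singleton p, by rw [norm_sub_rev]; exact norm_toy_rel_contactTime hpq hy⟩

/-- In the two-body toy the exterior particle has no clock instant. [folklore] -/
theorem clockInstants_toy_eq_empty (rec : 𝕏 → ℝ → 𝕏) (ε : ℝ) :
    clockInstants ε ({p} : Set 𝕏) ({p, q} : Set 𝕏) rec q = ∅ :=
  clockInstants_eq_empty fun q' hq' hq'W => by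
    rcases eq_or_eq_of_mem_labels hq' with rfl | rfl
    · exact absurd (mem_singleton _) hq'W
    · rfl

/-- **(G, existence) The toy trajectory is a slaved trajectory** for the window `{p}` in the
label set `{p, q}` with the two-body record, for every window datum `y` with `dist y P ≤ δ₀`:
every clause of `IsSlavedTrajectory` is checked — hard core, the single window contact, free
flights anchored at right endpoints, the non-grazing elastic response of the window particle with
the exterior particle's CURRENT velocity, the exterior particle starting from its recorded datum,
flying freely until the ACTUAL contact (no clock instant: its recorded recoil off the window
particle is dropped) and responding elastically there. [folklore] -/
theorem isSlavedTrajectory_toyTraj (hpq : p ≠ q) (hy : dist y R.P ≤ R.δ₀) :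
    IsSlavedTrajectory R.ε ({p} : Set 𝕏) ({p, q} : Set 𝕏) (R.recPath p) (R.toyTraj p y) where
  hardCore s hs p' hp' q' hq' hne := by
    rw [eq_of_mem_window hp'] at hne ⊢
    rcases eq_or_eq_of_mem_labels hq' with rfl | rfl
    · exact absurd rfl hne
    · exact le_norm_toy_rel hpq hy hs
  locFinite b := by
    refine (finite_singleton ((p, R.contactTime y) : 𝕏 × ℝ)).subset ?_
    rintro ⟨p', s⟩ ⟨hev, hp', hs⟩
    have hp'p : p' = p := eq_of_mem_window hp'
    subst hp'p
    obtain ⟨-, q', hq', hq'p, hcontact⟩ := mem_collisionEvents.1 hev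
    rcases eq_or_eq_of_mem_labels hq' with rfl | rfl
    · exact absurd rfl hq'p
    · rw [mem_singleton_iff, Prod.mk.injEq]
      exact ⟨rfl, (toy_contact_iff hpq hy hs.1).1 hcontact⟩
  pos_continuous p' hp' := by
    rw [eq_of_mem_window hp', toyTraj_self]
    exact (continuous_collidePath_fst _ _ _).continuousOn
  free p' hp' σ b hσ hσb hfree := by
    rw [eq_of_mem_window hp'] at hfree ⊢
    rw [toyTraj_self]
    refine collidePath_free hσb ?_
    by_contra h
    rw [not_or, not_le, not_lt] at h
    exact hfree _ ⟨h.2, h.1⟩ (toy_mem_collisionEvents hpq hy)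
  collision p' hp' q' hq' hne s hs hcontact := by
    rw [eq_of_mem_window hp'] at hne hcontact ⊢
    rcases eq_or_eq_of_mem_labels hq' with rfl | rfl
    · exact absurd rfl hne
    have hsT : s = R.contactTime y := (toy_contact_iff hpq hy hs).1 hcontact
    subst hsT
    refine ⟨fun q'' hq'' hq''p _ => ?_, ?_, ?_⟩
    · rcases eq_or_eq_of_mem_labels hq'' with rfl | rfl
      · exact absurd rfl hq''p
      · rfl
    · rw [toyTraj_self, R.toyTraj_of_ne y hpq.symm, collidePath_of_le le_rfl,
        collidePath_of_le le_rfl, impact_eq]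
      exact inner_relPos_contactTime_neg hy
    · rw [toyTraj_self, R.toyTraj_of_ne y hpq.symm, collidePath_of_le le_rfl,
        collidePath_of_le le_rfl]
      exact tendsto_collidePath_snd y R.Q (R.contactTime y)
  ext_zero q' hq' hq'W := by
    rcases eq_or_eq_of_mem_labels hq' with rfl | rfl
    · exact absurd (mem_singleton _) hq'W
    · rw [R.toyTraj_of_ne y hpq.symm, R.recPath_of_ne hpq.symm,
        collidePath_zero (contactTime_mem hy).1, collidePath_zero R.s₀_pos.le]
  ext_pos_continuous q' hq' hq'W := by
    rcases eq_or_eq_of_mem_labels hq' with rfl | rfl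
    · exact absurd (mem_singleton _) hq'W
    · rw [R.toyTraj_of_ne y hpq.symm]
      exact (continuous_collidePath_fst _ _ _).continuousOn
  ext_free q' hq' hq'W σ b hσ hσb hfree := by
    rcases eq_or_eq_of_mem_labels hq' with rfl | rfl
    · exact absurd (mem_singleton _) hq'W
    · rw [R.toyTraj_of_ne y hpq.symm]
      refine collidePath_free hσb ?_
      by_contra h
      rw [not_or, not_le, not_lt] at h
      exact hfree _ ⟨h.2, h.1⟩ (Or.inr (toy_mem_windowContactInstants hpq hy))
  ext_clock q' hq' hq'W s hs hcl w hw := by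
    rcases eq_or_eq_of_mem_labels hq' with rfl | rfl
    · exact absurd (mem_singleton _) hq'W
    · rw [clockInstants_toy_eq_empty] at hcl
      exact absurd hcl (notMem_empty _)
  ext_contact q' hq' hq'W p' hp' s hs hcontact := by
    rw [eq_of_mem_window hp'] at hcontact ⊢
    rcases eq_or_eq_of_mem_labels hq' with rfl | rfl
    · exact absurd (mem_singleton _) hq'W
    · rw [norm_sub_rev] at hcontact
      have hsT : s = R.contactTime y := (toy_contact_iff hpq hy hs).1 hcontact
      subst hsT
      rw [toyTraj_self, R.toyTraj_of_ne y hpq.symm, collidePath_of_le le_rfl,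
        collidePath_of_le le_rfl]
      exact tendsto_collidePath_snd R.Q y (R.contactTime y)

/-- The toy trajectory has window datum `y`. [folklore] -/
theorem toyTraj_zero (hy : dist y R.P ≤ R.δ₀) : R.toyTraj p y p 0 = y := by
  rw [toyTraj_self, collidePath_zero (contactTime_mem hy).1]

/-! ## 5. Uniqueness of the slaved trajectory with given window datum -/

/-- **Free flight after an instant is determined by the right limits there**: if `f` is in free
flight on `(T, b]` anchored at `b`, its velocity has the right limit `u` at `T` and its position
the right limit `xT`, then `f b = (xT + (b - T) u, u)`. [folklore] -/
theorem eq_of_free_after {f : ℝ → 𝕏} {T b : ℝ} {xT u : 𝔼} (hTb : T < b)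
    (hfree : ∀ σ ∈ Ioc T b, f σ = ((f b).1 + (σ - b) • (f b).2, (f b).2))
    (hvel : Tendsto (fun σ => (f σ).2) (𝓝[>] T) (𝓝 u))
    (hpos : Tendsto (fun σ => (f σ).1) (𝓝[>] T) (𝓝 xT)) : f b = (xT + (b - T) • u, u) := by
  have h1 : ∀ᶠ σ in 𝓝[>] T, (f b).2 = (f σ).2 := by
    filter_upwards [Ioo_mem_nhdsGT hTb] with σ hσ
    rw [hfree σ ⟨hσ.1, hσ.2.le⟩]
  have hv : (f b).2 = u := tendsto_nhds_unique (tendsto_const_nhds.congr' h1) hvel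
  have h2 : ∀ᶠ σ in 𝓝[>] T, (f b).1 + (σ - b) • (f b).2 = (f σ).1 := by
    filter_upwards [Ioo_mem_nhdsGT hTb] with σ hσ
    rw [hfree σ ⟨hσ.1, hσ.2.le⟩]
  have hcont : Tendsto (fun σ : ℝ => (f b).1 + (σ - b) • (f b).2) (𝓝[>] T)
      (𝓝 ((f b).1 + (T - b) • (f b).2)) :=
    ((continuous_const.add ((continuous_id.sub continuous_const).smul
      continuous_const)).tendsto T).mono_left nhdsWithin_le_nhds
  have hx : (f b).1 + (T - b) • (f b).2 = xT := tendsto_nhds_unique (hcont.congr' h2) hpos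
  refine Prod.ext ?_ hv
  rw [← hx, hv]
  module

variable {z : (EuclideanSpace ℝ d × EuclideanSpace ℝ d) → ℝ → EuclideanSpace ℝ d × EuclideanSpace ℝ d}

/-- In the two-body toy, a collision event of the window particle is a contact with `q`.
[folklore] -/
theorem mem_collisionEvents_toy_iff (hpq : p ≠ q) {ε τ : ℝ} :
    (p, τ) ∈ collisionEvents ε ({p, q} : Set 𝕏) z ↔ ‖(z p τ).1 - (z q τ).1‖ = ε := by
  refine ⟨fun h => ?_, fun h => ⟨by simp, q, by simp, hpq.symm, h⟩⟩
  obtain ⟨-, q', hq', hq'p, hcontact⟩ := mem_collisionEvents.1 h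
  rcases eq_or_eq_of_mem_labels hq' with rfl | rfl
  · exact absurd rfl hq'p
  · exact hcontact

/-- In the two-body toy, an exterior event of `q` is a contact with `p` (no clock instants).
[folklore] -/
theorem mem_exteriorEvents_toy_iff {ε τ : ℝ} {rec : 𝕏 → ℝ → 𝕏} :
    τ ∈ exteriorEvents ε ({p} : Set 𝕏) ({p, q} : Set 𝕏) rec z q ↔
      ‖(z p τ).1 - (z q τ).1‖ = ε := by
  rw [mem_exteriorEvents_iff, clockInstants_toy_eq_empty, mem_windowContactInstants_iff]
  simp only [mem_empty_iff_false, false_or, mem_singleton_iff, exists_eq_left]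
  rw [norm_sub_rev]

/-- **Before its first contact a slaved trajectory flies freely from its data** (window particle
from `y`, exterior particle from its recorded datum `Q`). [folklore] -/
theorem eq_free_of_noContact (hpq : p ≠ q)
    (hz : IsSlavedTrajectory R.ε ({p} : Set 𝕏) ({p, q} : Set 𝕏) (R.recPath p) z)
    (h0 : z p 0 = y) {b : ℝ} (hb : 0 ≤ b)
    (hnc : ∀ τ ∈ Ico 0 b, ‖(z p τ).1 - (z q τ).1‖ ≠ R.ε) :
    z p b = (y.1 + b • y.2, y.2) ∧ z q b = (R.Q.1 + b • R.Q.2, R.Q.2) := by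
  have hqW : q ∉ ({p} : Set 𝕏) := fun h => hpq (eq_of_mem_window h).symm
  constructor
  · have key := hz.free p (mem_singleton p) 0 b le_rfl hb fun τ hτ hev =>
      hnc τ hτ ((mem_collisionEvents_toy_iff hpq).1 hev)
    have h := eq_rigid_of_free_zero key (show (z p 0).2 = y.2 by rw [h0])
    rwa [h0] at h
  · have key := hz.ext_free q (by simp) hqW 0 b le_rfl hb fun τ hτ hev =>
      hnc τ hτ (mem_exteriorEvents_toy_iff.1 hev)
    have hq0 : z q 0 = R.Q := by
      rw [hz.ext_zero q (by simp) hqW, R.recPath_of_ne hpq.symm, collidePath_zero R.s₀_pos.le]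
    have h := eq_rigid_of_free_zero key (show (z q 0).2 = R.Q.2 by rw [hq0])
    rwa [hq0] at h

/-- The contact times of a slaved toy trajectory in a bounded time interval are finite.
[folklore] -/
theorem finite_contactTimes
    (hz : IsSlavedTrajectory R.ε ({p} : Set 𝕏) ({p, q} : Set 𝕏) (R.recPath p) z) (hpq : p ≠ q)
    (b : ℝ) : {τ : ℝ | τ ∈ Icc 0 b ∧ ‖(z p τ).1 - (z q τ).1‖ = R.ε}.Finite := by
  refine ((hz.locFinite b).image Prod.snd).subset ?_
  rintro τ ⟨hτ, hcontact⟩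
  exact ⟨(p, τ), ⟨(mem_collisionEvents_toy_iff hpq).2 hcontact, mem_singleton p, hτ⟩, rfl⟩

/-- **The first contact of any slaved trajectory with window datum `y` happens, at the perturbed
contact time** (early or late data still collide): no contact on `[0, contactTime y)` and contact
at `contactTime y`. [folklore] -/
theorem first_contact (hpq : p ≠ q) (hy : dist y R.P ≤ R.δ₀)
    (hz : IsSlavedTrajectory R.ε ({p} : Set 𝕏) ({p, q} : Set 𝕏) (R.recPath p) z)
    (h0 : z p 0 = y) :
    (∀ τ ∈ Ico 0 (R.contactTime y), ‖(z p τ).1 - (z q τ).1‖ ≠ R.ε) ∧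
      ‖(z p (R.contactTime y)).1 - (z q (R.contactTime y)).1‖ = R.ε := by
  set T := R.contactTime y with hT
  set b₁ := R.s₀ + R.η₁ with hb₁
  have hb₁0 : 0 ≤ b₁ := by rw [hb₁]; linarith [R.s₀_pos, R.η₁_pos]
  -- free flight from the data gives the relative position `relPos y`
  have hrel : ∀ {b : ℝ}, 0 ≤ b → (∀ τ ∈ Ico 0 b, ‖(z p τ).1 - (z q τ).1‖ ≠ R.ε) →
      (z p b).1 - (z q b).1 = R.relPos y b := by
    intro b hb hnc
    obtain ⟨hp, hq⟩ := eq_free_of_noContact hpq hz h0 hb hnc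
    rw [hp, hq, relPos]
    module
  -- there is a contact in `[0, s₀ + η₁]` (hard core at `s₀ + η₁` would fail otherwise)
  set F : Set ℝ := {τ : ℝ | τ ∈ Icc 0 b₁ ∧ ‖(z p τ).1 - (z q τ).1‖ = R.ε} with hF
  have hFfin : F.Finite := finite_contactTimes hz hpq b₁
  have hFne : F.Nonempty := by
    by_contra hne
    have hnc : ∀ τ ∈ Ico 0 b₁, ‖(z p τ).1 - (z q τ).1‖ ≠ R.ε := fun τ hτ h =>
      hne ⟨τ, ⟨hτ.1, hτ.2.le⟩, h⟩
    have hcore := hz.hardCore b₁ hb₁0 p (mem_singleton p) q (by simp) hpq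
    rw [hrel hb₁0 hnc] at hcore
    have hgap := gap_end_neg hy
    rw [gap] at hgap
    nlinarith [R.ε_pos, norm_nonneg (R.relPos y b₁)]
  -- its minimum `s₁` is the first contact
  have hFne' : hFfin.toFinset.Nonempty := by simpa using hFne
  set s₁ := hFfin.toFinset.min' hFne' with hs₁
  have hs₁F : s₁ ∈ F := by simpa using hFfin.toFinset.min'_mem hFne'
  have hmin : ∀ τ ∈ F, s₁ ≤ τ := fun τ hτ => hFfin.toFinset.min'_le τ (by simpa using hτ)
  obtain ⟨⟨hs₁0, hs₁b⟩, hs₁c⟩ := hs₁F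
  have hnc₁ : ∀ τ ∈ Ico 0 s₁, ‖(z p τ).1 - (z q τ).1‖ ≠ R.ε := fun τ hτ h =>
    absurd (hmin τ ⟨⟨hτ.1, hτ.2.le.trans hs₁b⟩, h⟩) (not_le.2 hτ.2)
  -- and `s₁ = T`
  have hgap₁ : R.gap y s₁ = 0 := by
    rw [gap, ← hrel hs₁0 hnc₁, hs₁c, sub_self]
  have hs₁T : s₁ = T := by
    rcases lt_trichotomy s₁ T with hlt | heq | hgt
    · exact absurd hgap₁ (gap_pos_of_lt_contactTime hs₁0 hlt).ne'
    · exact heq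
    · exfalso
      refine hnc₁ T ⟨(contactTime_mem hy).1, hgt⟩ ?_
      rw [hrel (contactTime_mem hy).1 fun τ hτ => hnc₁ τ ⟨hτ.1, hτ.2.trans hgt⟩]
      exact norm_relPos_contactTime hy
  rw [← hs₁T]
  exact ⟨hnc₁, hs₁c⟩

/-- Up to the contact time a slaved trajectory with window datum `y` is the toy trajectory.
[folklore] -/
theorem eq_toyTraj_of_le (hpq : p ≠ q) (hy : dist y R.P ≤ R.δ₀)
    (hz : IsSlavedTrajectory R.ε ({p} : Set 𝕏) ({p, q} : Set 𝕏) (R.recPath p) z)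
    (h0 : z p 0 = y) {s : ℝ} (hs0 : 0 ≤ s) (hs : s ≤ R.contactTime y) :
    z p s = R.toyTraj p y p s ∧ z q s = R.toyTraj p y q s := by
  obtain ⟨hp, hq⟩ := eq_free_of_noContact hpq hz h0 hs0 fun τ hτ =>
    (first_contact hpq hy hz h0).1 τ ⟨hτ.1, hτ.2.trans_le hs⟩
  rw [hp, hq, toyTraj_self, R.toyTraj_of_ne y hpq.symm, collidePath_of_le hs, collidePath_of_le hs]
  exact ⟨rfl, rfl⟩

/-- **After the contact, free flight with the elastic outgoing velocities** as long as no further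
contact occurs: the right limits of the velocities at the contact are the elastic ones (window
clause for `p`, exterior clause for `q`), positions are continuous, and free flight is anchored
at the right endpoint. [folklore] -/
theorem eq_after_of_noContact (hpq : p ≠ q) (hy : dist y R.P ≤ R.δ₀)
    (hz : IsSlavedTrajectory R.ε ({p} : Set 𝕏) ({p, q} : Set 𝕏) (R.recPath p) z)
    (h0 : z p 0 = y) {b : ℝ} (hb : R.contactTime y < b)
    (hnc : ∀ τ ∈ Ioo (R.contactTime y) b, ‖(z p τ).1 - (z q τ).1‖ ≠ R.ε) :
    z p b = (y.1 + R.contactTime y • y.2 + (b - R.contactTime y) • R.uOut y, R.uOut y) ∧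
      z q b = (R.Q.1 + R.contactTime y • R.Q.2 + (b - R.contactTime y) • R.uOutQ y, R.uOutQ y) := by
  set T := R.contactTime y with hT
  have hT0 : 0 ≤ T := (contactTime_mem hy).1
  have hqW : q ∉ ({p} : Set 𝕏) := fun h => hpq (eq_of_mem_window h).symm
  obtain ⟨hpT, hqT⟩ := eq_toyTraj_of_le hpq hy hz h0 hT0 le_rfl
  rw [toyTraj_self, collidePath_of_le le_rfl] at hpT
  rw [R.toyTraj_of_ne y hpq.symm, collidePath_of_le le_rfl] at hqT
  have hcontact := (first_contact hpq hy hz h0).2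
  -- right limits of the velocities at `T`
  have hvp : Tendsto (fun σ => (z p σ).2) (𝓝[>] T) (𝓝 (R.uOut y)) := by
    have h := (hz.collision p (mem_singleton p) q (by simp) hpq T hT0 hcontact).2.2
    rwa [hpT, hqT] at h
  have hvq : Tendsto (fun σ => (z q σ).2) (𝓝[>] T) (𝓝 (R.uOutQ y)) := by
    have h := hz.ext_contact q (by simp) hqW p (mem_singleton p) T hT0
      (by rw [norm_sub_rev]; exact hcontact)
    rwa [hpT, hqT] at h
  -- right limits of the positions at `T` (continuity on `[0, ∞)`)
  have hle : 𝓝[>] T ≤ 𝓝[Ici 0] T := nhdsWithin_mono T fun σ hσ => hT0.trans (le_of_lt hσ)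
  have hxp : Tendsto (fun σ => (z p σ).1) (𝓝[>] T) (𝓝 (y.1 + T • y.2)) := by
    have h := ((hz.pos_continuous p (mem_singleton p)) T hT0).tendsto.mono_left hle
    rwa [hpT] at h
  have hxq : Tendsto (fun σ => (z q σ).1) (𝓝[>] T) (𝓝 (R.Q.1 + T • R.Q.2)) := by
    have h := ((hz.ext_pos_continuous q (by simp) hqW) T hT0).tendsto.mono_left hle
    rwa [hqT] at h
  -- free flight on `(T, b]`
  have hfp : ∀ σ ∈ Ioc T b, z p σ = ((z p b).1 + (σ - b) • (z p b).2, (z p b).2) :=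
    fun σ hσ => hz.free p (mem_singleton p) σ b (hT0.trans hσ.1.le) hσ.2 fun τ hτ hev =>
      hnc τ ⟨hσ.1.trans_le hτ.1, hτ.2⟩ ((mem_collisionEvents_toy_iff hpq).1 hev)
  have hfq : ∀ σ ∈ Ioc T b, z q σ = ((z q b).1 + (σ - b) • (z q b).2, (z q b).2) :=
    fun σ hσ => hz.ext_free q (by simp) hqW σ b (hT0.trans hσ.1.le) hσ.2 fun τ hτ hev =>
      hnc τ ⟨hσ.1.trans_le hτ.1, hτ.2⟩ (mem_exteriorEvents_toy_iff.1 hev)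
  exact ⟨eq_of_free_after hb hfp hvp hxp, eq_of_free_after hb hfq hvq hxq⟩

/-- **No second contact**: after the contact time a slaved trajectory with window datum `y`
never touches again (the reflected pair separates). [folklore] -/
theorem noContact_after (hpq : p ≠ q) (hy : dist y R.P ≤ R.δ₀)
    (hz : IsSlavedTrajectory R.ε ({p} : Set 𝕏) ({p, q} : Set 𝕏) (R.recPath p) z)
    (h0 : z p 0 = y) {τ : ℝ} (hτ : R.contactTime y < τ) : ‖(z p τ).1 - (z q τ).1‖ ≠ R.ε := by
  intro hcτ
  set T := R.contactTime y with hT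
  have hT0 : 0 ≤ T := (contactTime_mem hy).1
  -- the first contact after `T`
  set F : Set ℝ := {σ : ℝ | σ ∈ Icc 0 τ ∧ ‖(z p σ).1 - (z q σ).1‖ = R.ε} ∩ Ioi T with hF
  have hFfin : F.Finite := (finite_contactTimes hz hpq τ).subset inter_subset_left
  have hτF : τ ∈ F := ⟨⟨⟨hT0.trans hτ.le, le_rfl⟩, hcτ⟩, hτ⟩
  have hFne' : hFfin.toFinset.Nonempty := ⟨τ, by simpa using hτF⟩
  set s₂ := hFfin.toFinset.min' hFne' with hs₂
  have hs₂F : s₂ ∈ F := by simpa using hFfin.toFinset.min'_mem hFne'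
  have hmin : ∀ σ ∈ F, s₂ ≤ σ := fun σ hσ => hFfin.toFinset.min'_le σ (by simpa using hσ)
  obtain ⟨⟨⟨-, hs₂τ⟩, hs₂c⟩, hTs₂⟩ := hs₂F
  have hnc : ∀ σ ∈ Ioo T s₂, ‖(z p σ).1 - (z q σ).1‖ ≠ R.ε := fun σ hσ h =>
    absurd (hmin σ ⟨⟨⟨hT0.trans hσ.1.le, hσ.2.le.trans hs₂τ⟩, h⟩, hσ.1⟩) (not_le.2 hσ.2)
  obtain ⟨hp, hq⟩ := eq_after_of_noContact hpq hy hz h0 hTs₂ hnc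
  have hrel : (z p s₂).1 - (z q s₂).1 = R.relPos y T + (s₂ - T) • (R.uOut y - R.uOutQ y) := by
    rw [hp, hq, relPos]
    module
  rw [hrel] at hs₂c
  exact (lt_norm_add_smul_of_inner_pos (norm_relPos_contactTime hy) (inner_relPos_uOut_sub_pos hy)
    (sub_pos.2 hTs₂)).ne' hs₂c

/-- **(G, uniqueness) Every slaved trajectory with window datum `y` is the toy trajectory** on
`[0, ∞)` (both particles). [folklore] -/
theorem eq_toyTraj (hpq : p ≠ q) (hy : dist y R.P ≤ R.δ₀)
    (hz : IsSlavedTrajectory R.ε ({p} : Set 𝕏) ({p, q} : Set 𝕏) (R.recPath p) z)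
    (h0 : z p 0 = y) {s : ℝ} (hs0 : 0 ≤ s) :
    z p s = R.toyTraj p y p s ∧ z q s = R.toyTraj p y q s := by
  rcases le_or_gt s (R.contactTime y) with hs | hs
  · exact eq_toyTraj_of_le hpq hy hz h0 hs0 hs
  · obtain ⟨hp, hq⟩ := eq_after_of_noContact hpq hy hz h0 hs fun τ hτ =>
      noContact_after hpq hy hz h0 hτ.1
    rw [hp, hq, toyTraj_self, R.toyTraj_of_ne y hpq.symm, collidePath_of_lt hs,
      collidePath_of_lt hs]
    exact ⟨rfl, rfl⟩

end Toy

/-- On the record itself the perturbed contact time is the recorded one. [folklore] -/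
theorem contactTime_self : R.contactTime R.P = R.s₀ := by
  have h := abs_contactTime_sub_s₀_le (R := R) (y := R.P) (by rw [dist_self]; exact R.δ₀_pos.le)
  rw [dist_self, mul_zero] at h
  exact sub_eq_zero.1 (abs_nonpos_iff.1 h)

/-- **Consistency of the toy**: with the recorded window datum the toy trajectory IS the record
(so the record is itself a slaved trajectory, `isSlavedTrajectory_toyTraj` at `y = P`).
[folklore] -/
theorem toyTraj_self_eq_recPath (p : 𝕏) : R.toyTraj p R.P = R.recPath p := by
  funext r
  by_cases h : r = p
  · rw [h, toyTraj_self, recPath_self, contactTime_self]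
  · rw [R.toyTraj_of_ne _ h, R.recPath_of_ne h, contactTime_self]

/-- The record is a slaved trajectory of the toy (window datum `P`). [folklore] -/
theorem isSlavedTrajectory_recPath {p q : 𝕏} (hpq : p ≠ q) :
    IsSlavedTrajectory R.ε ({p} : Set 𝕏) ({p, q} : Set 𝕏) (R.recPath p) (R.recPath p) := by
  have h := isSlavedTrajectory_toyTraj (R := R) (y := R.P) hpq
    (by rw [dist_self]; exact R.δ₀_pos.le)
  rwa [toyTraj_self_eq_recPath] at h

/-! ## 6. Lipschitz response and the headline theorem -/

/-- The Lipschitz constant of the outgoing velocity in the window datum. [folklore] -/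
def Cv : ℝ :=
  1 + R.Li / R.ε + R.κ * R.Ln / R.ε ^ 2

/-- `Cv ≥ 0`. [folklore] -/
theorem Cv_nonneg : 0 ≤ R.Cv := by
  have := R.Li_pos
  have := R.ε_pos
  have := R.κ_pos
  have := R.Ln_nonneg
  unfold Cv
  positivity

/-- The Lipschitz constant of the final state in the window datum. [folklore] -/
def Cfin : ℝ :=
  1 + (R.s₀ + 1) + R.Lg / R.κ * ‖R.P.2‖ + (R.s₀ + 1) * R.Cv + R.Lg / R.κ * ‖postVel R.P R.Q R.s₀‖

/-- `Cv ≤ Cfin`. [folklore] -/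
theorem Cv_le_Cfin : R.Cv ≤ R.Cfin := by
  have := R.s₀_pos
  have := R.Lg_pos
  have := R.κ_pos
  have := R.Cv_nonneg
  have h1 : 0 ≤ R.Lg / R.κ * ‖R.P.2‖ := by positivity
  have h2 : 0 ≤ R.Lg / R.κ * ‖postVel R.P R.Q R.s₀‖ := by positivity
  unfold Cfin
  nlinarith

/-- `Cfin ≥ 0`. [folklore] -/
theorem Cfin_nonneg : 0 ≤ R.Cfin :=
  R.Cv_nonneg.trans R.Cv_le_Cfin

section Estimates

variable {R} {y : EuclideanSpace ℝ d × EuclideanSpace ℝ d}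

/-- First component of the reflection law, unfolded. [folklore] -/
theorem reflectVel_fst_eq (n v w : 𝔼) :
    (reflectVel n (v, w)).1 = v - (⟪v - w, n⟫_ℝ / ‖n‖ ^ 2) • n :=
  rfl

/-- **The outgoing velocity is Lipschitz in the window datum at the record**:
`‖uOut y - u₀'‖ ≤ Cv · dist y P`, `u₀' = postVel P Q s₀` the recorded outgoing velocity.
[folklore] -/
theorem norm_uOut_sub_le (hy : dist y R.P ≤ R.δ₀) :
    ‖R.uOut y - postVel R.P R.Q R.s₀‖ ≤ R.Cv * dist y R.P := by
  set n := R.relPos y (R.contactTime y) with hn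
  set w : 𝔼 := y.2 - R.Q.2 with hw
  have hε := R.ε_pos
  have hnε : ‖n‖ = R.ε := norm_relPos_contactTime hy
  have hI : (y.1 + R.contactTime y • y.2) - (R.Q.1 + R.contactTime y • R.Q.2) = n := by
    rw [hn]
    exact impact_eq _ _ _
  have h1 : R.uOut y = y.2 - (⟪w, n⟫_ℝ / R.ε ^ 2) • n := by
    rw [uOut, postVel, hI, reflectVel_fst_eq, hnε]
  have h2 : postVel R.P R.Q R.s₀ = R.P.2 - (⟪R.w₀, R.n₀⟫_ℝ / R.ε ^ 2) • R.n₀ := by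
    rw [postVel, impact_eq, reflectVel_fst_eq, ← n₀_eq, R.norm_n₀]
    rfl
  have hsplit : R.uOut y - postVel R.P R.Q R.s₀ =
      (y.2 - R.P.2) - (((⟪w, n⟫_ℝ - ⟪R.w₀, R.n₀⟫_ℝ) / R.ε ^ 2) • n +
        (⟪R.w₀, R.n₀⟫_ℝ / R.ε ^ 2) • (n - R.n₀)) := by
    rw [h1, h2, sub_div, sub_smul, smul_sub]
    abel
  have hinner : |⟪w, n⟫_ℝ - ⟪R.w₀, R.n₀⟫_ℝ| ≤ R.Li * dist y R.P := by
    rw [real_inner_comm n w, real_inner_comm R.n₀ R.w₀]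
    exact abs_inner_sub_le hy
  have hκ : |⟪R.w₀, R.n₀⟫_ℝ| = R.κ := by
    have hg : ⟪R.n₀, R.w₀⟫_ℝ < 0 := R.graze
    rw [real_inner_comm, κ, abs_of_neg hg]
  rw [hsplit]
  refine (norm_sub_le _ _).trans ?_
  have hA : ‖y.2 - R.P.2‖ ≤ dist y R.P := by rw [← dist_eq_norm]; exact dist_snd_le' y R.P
  have hB : ‖((⟪w, n⟫_ℝ - ⟪R.w₀, R.n₀⟫_ℝ) / R.ε ^ 2) • n‖ ≤ R.Li / R.ε * dist y R.P := by
    rw [norm_smul, Real.norm_eq_abs, abs_div, abs_of_pos (pow_pos hε 2), hnε]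
    calc |⟪w, n⟫_ℝ - ⟪R.w₀, R.n₀⟫_ℝ| / R.ε ^ 2 * R.ε
        ≤ R.Li * dist y R.P / R.ε ^ 2 * R.ε := by gcongr
      _ = R.Li / R.ε * dist y R.P := by field_simp
  have hC : ‖(⟪R.w₀, R.n₀⟫_ℝ / R.ε ^ 2) • (n - R.n₀)‖ ≤ R.κ * R.Ln / R.ε ^ 2 * dist y R.P := by
    rw [norm_smul, Real.norm_eq_abs, abs_div, abs_of_pos (pow_pos hε 2), hκ]
    calc R.κ / R.ε ^ 2 * ‖n - R.n₀‖ ≤ R.κ / R.ε ^ 2 * (R.Ln * dist y R.P) :=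
          mul_le_mul_of_nonneg_left (norm_relPos_contactTime_sub_n₀_le hy)
            (div_nonneg R.κ_pos.le (pow_pos hε 2).le)
      _ = R.κ * R.Ln / R.ε ^ 2 * dist y R.P := by ring
  calc ‖y.2 - R.P.2‖ + ‖((⟪w, n⟫_ℝ - ⟪R.w₀, R.n₀⟫_ℝ) / R.ε ^ 2) • n +
        (⟪R.w₀, R.n₀⟫_ℝ / R.ε ^ 2) • (n - R.n₀)‖
      ≤ dist y R.P + (R.Li / R.ε * dist y R.P + R.κ * R.Ln / R.ε ^ 2 * dist y R.P) :=
        add_le_add hA ((norm_add_le _ _).trans (add_le_add hB hC))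
    _ = R.Cv * dist y R.P := by rw [Cv]; ring

/-- The recorded window path after the recorded contact. [folklore] -/
theorem recPath_self_of_lt (p : 𝕏) {s : ℝ} (hs : R.s₀ < s) :
    R.recPath p p s = (R.P.1 + R.s₀ • R.P.2 + (s - R.s₀) • postVel R.P R.Q R.s₀,
      postVel R.P R.Q R.s₀) := by
  rw [recPath_self, collidePath_of_lt hs]

/-- **The outgoing velocity of the window particle stays within `Cv · dist y P` of the recorded
one** at all times after the perturbed contact. [folklore] -/
theorem norm_toyTraj_snd_sub_le (p : 𝕏) (hy : dist y R.P ≤ R.δ₀) {s : ℝ}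
    (hs : R.contactTime y < s) :
    ‖(R.toyTraj p y p s).2 - postVel R.P R.Q R.s₀‖ ≤ R.Cv * dist y R.P := by
  rw [toyTraj_self, collidePath_of_lt hs]
  exact norm_uOut_sub_le hy

/-- The final time `s₀ + 1` is after the perturbed contact. [folklore] -/
theorem contactTime_lt_final (hy : dist y R.P ≤ R.δ₀) : R.contactTime y < R.s₀ + 1 := by
  linarith [contactTime_le hy, R.η₁_le_half]

/-- **The final state of the window particle is Lipschitz in the window datum at the record**:
at time `s₀ + 1` the toy state of `p` is within `Cfin · dist y P` of the recorded one. [folklore] -/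
theorem dist_toyTraj_final_le (p : 𝕏) (hy : dist y R.P ≤ R.δ₀) :
    dist (R.toyTraj p y p (R.s₀ + 1)) (R.recPath p p (R.s₀ + 1)) ≤ R.Cfin * dist y R.P := by
  set T := R.contactTime y with hT
  set sf := R.s₀ + 1 with hsf
  set u := R.uOut y with hu
  set u₀ := postVel R.P R.Q R.s₀ with hu₀
  set δ := dist y R.P with hδ
  have hTsf : T < sf := contactTime_lt_final hy
  have hTI := contactTime_mem_Icc hy
  have hκ := R.κ_pos
  have hLg := R.Lg_pos
  have hTs₀ : |T - R.s₀| ≤ R.Lg / R.κ * δ := abs_contactTime_sub_s₀_le hy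
  have hvel : ‖u - u₀‖ ≤ R.Cv * δ := norm_uOut_sub_le hy
  rw [toyTraj_self, collidePath_of_lt hTsf, R.recPath_self_of_lt p (by linarith [R.s₀_pos]),
    Prod.dist_eq, max_le_iff]
  refine ⟨?_, ?_⟩
  · -- positions
    rw [dist_eq_norm]
    have hsplit : y.1 + T • y.2 + (sf - T) • postVel y R.Q T -
        (R.P.1 + R.s₀ • R.P.2 + (sf - R.s₀) • u₀) =
        (y.1 - R.P.1) + (T • (y.2 - R.P.2) + (T - R.s₀) • R.P.2) +
          ((sf - T) • (u - u₀) + (R.s₀ - T) • u₀) := by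
      simp only [hu, uOut, ← hT]
      module
    rw [hsplit]
    have h1 : ‖y.1 - R.P.1‖ ≤ δ := by rw [← dist_eq_norm]; exact dist_fst_le' y R.P
    have h2 : ‖T • (y.2 - R.P.2)‖ ≤ (R.s₀ + 1) * δ := by
      rw [norm_smul, Real.norm_eq_abs, abs_of_nonneg hTI.1, ← dist_eq_norm]
      exact mul_le_mul hTI.2 (dist_snd_le' y R.P) dist_nonneg (by linarith [R.s₀_pos])
    have h3 : ‖(T - R.s₀) • R.P.2‖ ≤ R.Lg / R.κ * ‖R.P.2‖ * δ := by
      rw [norm_smul, Real.norm_eq_abs]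
      calc |T - R.s₀| * ‖R.P.2‖ ≤ R.Lg / R.κ * δ * ‖R.P.2‖ :=
            mul_le_mul_of_nonneg_right hTs₀ (norm_nonneg _)
        _ = R.Lg / R.κ * ‖R.P.2‖ * δ := by ring
    have h4 : ‖(sf - T) • (u - u₀)‖ ≤ (R.s₀ + 1) * R.Cv * δ := by
      rw [norm_smul, Real.norm_eq_abs, abs_of_nonneg (sub_nonneg.2 hTsf.le), mul_assoc]
      exact mul_le_mul (by rw [hsf]; linarith [hTI.1]) hvel (norm_nonneg _)
        (by linarith [R.s₀_pos])
    have h5 : ‖(R.s₀ - T) • u₀‖ ≤ R.Lg / R.κ * ‖u₀‖ * δ := by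
      rw [norm_smul, Real.norm_eq_abs, abs_sub_comm]
      calc |T - R.s₀| * ‖u₀‖ ≤ R.Lg / R.κ * δ * ‖u₀‖ :=
            mul_le_mul_of_nonneg_right hTs₀ (norm_nonneg _)
        _ = R.Lg / R.κ * ‖u₀‖ * δ := by ring
    calc ‖(y.1 - R.P.1) + (T • (y.2 - R.P.2) + (T - R.s₀) • R.P.2) +
          ((sf - T) • (u - u₀) + (R.s₀ - T) • u₀)‖
        ≤ ‖y.1 - R.P.1‖ + (‖T • (y.2 - R.P.2)‖ + ‖(T - R.s₀) • R.P.2‖) +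
          (‖(sf - T) • (u - u₀)‖ + ‖(R.s₀ - T) • u₀‖) :=
          norm_add₃_le.trans (add_le_add (add_le_add le_rfl (norm_add_le _ _)) (norm_add_le _ _))
      _ ≤ δ + ((R.s₀ + 1) * δ + R.Lg / R.κ * ‖R.P.2‖ * δ) +
          ((R.s₀ + 1) * R.Cv * δ + R.Lg / R.κ * ‖u₀‖ * δ) :=
          add_le_add (add_le_add h1 (add_le_add h2 h3)) (add_le_add h4 h5)
      _ = R.Cfin * δ := by rw [Cfin]; ring
  · -- velocities
    rw [dist_eq_norm]
    exact hvel.trans (mul_le_mul_of_nonneg_right R.Cv_le_Cfin dist_nonneg)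

end Estimates

/-- **NO GHOST RECOIL (acceptance lemma (G) of `defn-SlavedUnstablePlaques`).** In the two-body toy
of the contact-slaved window dynamics — window `{p}`, exterior `{q}`, record = two free flights
with one non-grazing contact at reversed time `s₀ > 0` — there are `δ > 0` and `C ≥ 0` such that for
every window datum `y` with `dist y P ≤ δ`:
(i) EXISTENCE: the toy trajectory `toyTraj p y` is a slaved trajectory with window datum `y`;
(ii) UNIQUENESS: every slaved trajectory `z` with `z p 0 = y` equals it at all `s ≥ 0`;
(iii) ONE CONTACT: on `[0, ∞)` the particles touch exactly at `contactTime y`, and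
`|contactTime y - s₀| ≤ C · dist y P` — EARLY OR LATE DATA STILL COLLIDE (in D4's dynamics late data
miss the partner, which has recoiled on the clock);
(iv) LIPSCHITZ RESPONSE: after the contact the velocity of `p` is within `C · dist y P` of the
recorded outgoing velocity `postVel P Q s₀`, and the state of `p` at the final time `s₀ + 1` is
within `C · dist y P` of the recorded state. [folklore] -/
theorem noGhostRecoil {p q : 𝕏} (hpq : p ≠ q) :
    ∃ δ C : ℝ, 0 < δ ∧ 0 ≤ C ∧ ∀ y : 𝕏, dist y R.P ≤ δ →
      (IsSlavedTrajectory R.ε ({p} : Set 𝕏) ({p, q} : Set 𝕏) (R.recPath p) (R.toyTraj p y) ∧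
        R.toyTraj p y p 0 = y) ∧
      (∀ z : 𝕏 → ℝ → 𝕏, IsSlavedTrajectory R.ε ({p} : Set 𝕏) ({p, q} : Set 𝕏) (R.recPath p) z →
        z p 0 = y → ∀ s : ℝ, 0 ≤ s → z p s = R.toyTraj p y p s ∧ z q s = R.toyTraj p y q s) ∧
      (∀ s : ℝ, 0 ≤ s →
        (‖(R.toyTraj p y p s).1 - (R.toyTraj p y q s).1‖ = R.ε ↔ s = R.contactTime y)) ∧
      |R.contactTime y - R.s₀| ≤ C * dist y R.P ∧
      (∀ s : ℝ, R.contactTime y < s →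
        ‖(R.toyTraj p y p s).2 - postVel R.P R.Q R.s₀‖ ≤ C * dist y R.P) ∧
      dist (R.toyTraj p y p (R.s₀ + 1)) (R.recPath p p (R.s₀ + 1)) ≤ C * dist y R.P := by
  have hr : 0 ≤ R.Lg / R.κ := div_nonneg R.Lg_pos.le R.κ_pos.le
  have hC0 := R.Cfin_nonneg
  have h1 : R.Lg / R.κ ≤ R.Cfin + R.Lg / R.κ := by linarith
  have h2 : R.Cfin ≤ R.Cfin + R.Lg / R.κ := by linarith
  have h3 : R.Cv ≤ R.Cfin + R.Lg / R.κ := R.Cv_le_Cfin.trans h2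
  refine ⟨R.δ₀, R.Cfin + R.Lg / R.κ, R.δ₀_pos, by linarith,
    fun y hy => ⟨?_, ?_, ?_, ?_, ?_, ?_⟩⟩
  · exact ⟨isSlavedTrajectory_toyTraj hpq hy, toyTraj_zero hy⟩
  · exact fun z hz h0 s hs => eq_toyTraj hpq hy hz h0 hs
  · exact fun s hs => toy_contact_iff hpq hy hs
  · exact (abs_contactTime_sub_s₀_le hy).trans (mul_le_mul_of_nonneg_right h1 dist_nonneg)
  · exact fun s hs => (norm_toyTraj_snd_sub_le p hy hs).trans
      (mul_le_mul_of_nonneg_right h3 dist_nonneg)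
  · exact (dist_toyTraj_final_le p hy).trans (mul_le_mul_of_nonneg_right h2 dist_nonneg)

end TwoBodyRecord

end NoGhostFile

end Literature.Dynamics.Billiards
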